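/-
Copyright: H21 K2-LIT squad (hodgecm-mathlib). Helper for crux hLiu418 = `stmt-HodgeConjecture-24832`
(route `route-HodgeConjecture-HCCMUnconditional`), G-road arch debt «(D-ht)» (LEAD ruling «M-156h», G2-PS-B, file B3b).
-/
import Summits.HodgeConjecture.HodgeConjecture.Theorems.K2LiuIwasawaHeightGramFunction           -- ★ B3a: reduction to `gramHeightFun`, differentiability
import HarnessLib

/-!
# The Iwasawa height is differentiable along archimedean one-parameter orbits, with a `K`-finite log-derivative (STANDARD data)

This file pays the arch debt «(D-ht)» of SIGS-RoadI-v3: it discharges, for a STANDARD Iwasawa datum `𝒦` (★ `IwasawaDatum.IsStd`) and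
`X ∈ 𝔥_∞ = archSkew`, the two by-value inputs `hH`, `hHK` of ★ `K2LiuFlatSectionLieDerivative.hasDerivAt_stdExtension_orbit`:

**`exists_heightDeriv_of_isStd`** — `∃ H : H(𝔸) → ℝ, (∀ h, HasDerivAt (fun t => Φ_𝒦 (h · γ_X t)) (Φ_𝒦 h · H h) 0) ∧ IsKFinite 𝒦 H`.

Route (steps 1–4 are ★ B3a `K2LiuIwasawaHeightGramFunction`; this file does step 5; no Lie theory, no Iwasawa coordinates beyond ★ `IwasawaDatum.kPart`):
1. `iwasawaHeight_mul_archEmb` — `Φ_𝒦(h · (z,1)) = Φ_𝒦 h · Φ_𝒦((c_h z, 1))`, `c_h = (𝒦.kPart h)_∞ ∈ C_∞` (★ B1, generalised to any `z ∈ H_∞`);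
2. `iwasawaHeight_archEmb_expGL_eq` — `Φ_𝒦((c · exp tX, 1)) = gramHeightFun S c (exp(−tX))` (★ B1 `iwasawaHeight_archEmb_sq`: the height of an
   archimedean element is a product of Gram-determinant ratios; `gramHeightFun` extends it to the whole matrix space);
3. `gramHeightFun_mul_right` — `gramHeightFun S (c k) Y = gramHeightFun S c (k Y k⁻¹)` for `S⁻¹ k S` unitary (★ B2 unitary invariance);
4. `differentiableAt_gramHeightFun`, `hasDerivAt_gramHeightFun_exp` — Fréchet differentiability at `1` (★ B2 `contDiff_siegelGram_mul`, positivity)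
   and the chain rule along `t ↦ exp(−tX)`, whose derivative `(D gramHeightFun)(1)(−X)` is LINEAR in `X`;
5. `hasDerivAt_iwasawaHeight_orbit` — `hH` with `H = heightDeriv 𝒦 S X`; `heightDeriv_mul_K` — `H_X(h k') = (D gramHeightFun_{c_h})(1)(−Ad(k'_∞)X)`
   (`k' γ_X(t) k'⁻¹ = (Ad(k'_∞) exp tX, 1)` and uniqueness of derivatives); hence `isKFinite_heightDeriv` — all right `K`-translates of `H_X` lie in
   the complex span of the image of the finite-dimensional real matrix space under the linear map `Z ↦ (h ↦ (D gramHeightFun_{c_h})(1)(Z))`.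

[cite: KudlaRallis1994, §1 (standard sections, `|a(g)|`)] [cite: Weil1964, Chap. I n° 8 (majorants)] [cite: Tan1999, §1 p. 166]
[cite: Knapp2002, 0.§2 Prop. 0.11 (one-parameter subgroups, `Ad`)] [cite: BorelJacquet1979, §4.1]
-/

set_option linter.dupNamespace false -- the mandated namespace repeats `HodgeConjecture.HodgeConjecture`

open Literature.NumberTheory.Automorphic Literature.NumberTheory.Automorphic.UnitaryGroup
open Literature.NumberTheory.GaloisRepresentations
open Literature.NumberTheory.GelbartRogawski1991 Literature.NumberTheory.GelbartRogawski1991.GRConstruction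
open Literature.NumberTheory.K2Lit.SiegelDoubled
-- `Classical` is needed to see the Mathlib normed-space instances on `mixedSpace L` (note H5 of `AdelicGLnGlue`)
open scoped Classical
open scoped Matrix ComplexOrder Matrix.Norms.Operator ContDiff
open NumberField NumberField.mixedEmbedding NumberField.InfinitePlace IsDedekindDomain

set_option backward.isDefEq.respectTransparency false

namespace Summit.HodgeConjecture.HodgeConjecture.Cruxes.HLiu418.K2LiuIwasawaHeightLieDerivative

open Summit.HodgeConjecture.HodgeConjecture.Cruxes.HLiu418.K2LiuArchOneParameterOrbitDefs
open Summit.HodgeConjecture.HodgeConjecture.Cruxes.HLiu418.K2LiuSiegelGramDeterminantDefs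
open Summit.HodgeConjecture.HodgeConjecture.Cruxes.HLiu418.K2LiuSiegelGramDeterminant
open Summit.HodgeConjecture.HodgeConjecture.Cruxes.HLiu418.K2LiuIwasawaHeightContinuous
open Summit.HodgeConjecture.HodgeConjecture.Cruxes.HLiu418.K2LiuIwasawaHeightArchReduction
open Summit.HodgeConjecture.HodgeConjecture.Cruxes.HLiu418.K2LiuIwasawaHeightLieDerivativeDefs
open Summit.HodgeConjecture.HodgeConjecture.Cruxes.HLiu418.K2LiuIwasawaHeightGramFunction

variable (L : Type) [Field L] [NumberField L] [IsCMField L]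
variable {N M n : ℕ} (e : Fin N × Fin M ≃ Fin n)
  (dV : Fin N → L) (hdV : ∀ i, IsCMField.complexConj L (dV i) = dV i) (hdV0 : ∀ i, dV i ≠ 0)
  (dW : Fin M → L) (hdW : ∀ i, IsCMField.complexConj L (dW i) = dW i) (hdW0 : ∀ i, dW i ≠ 0)
variable (𝒦 : IwasawaDatum L e dV hdV dW hdW)
variable {X : Matrix (Fin (n + n)) (Fin (n + n)) (mixedSpace L)}
  (hX : X ∈ archSkew (Fp L) L (IsCMField.complexConj L) (n + n) (hermD L e dV hdV dW hdW))

/-! ## 3. The derivative of the height along the orbit, its right `K`-translates, `K`-finiteness -/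

section Orbit

variable {Cinf : Subgroup (arch (Fp L) L (IsCMField.complexConj L) (n + n) (hermD L e dV hdV dW hdW))}
  {S : GL (Fin (n + n)) (mixedSpace L)}

include hdV0 hdW0 in
/-- **`hH`: the Iwasawa height is differentiable along `h · γ_X(t)` with log-derivative `heightDeriv 𝒦 S X h`** (standard data).
[cite: KudlaRallis1994, §1] [cite: Tan1999, §1 p. 166] -/
theorem hasDerivAt_iwasawaHeight_orbit (h𝒦 : 𝒦.IsStd)
    (hC : ∀ a : arch (Fp L) L (IsCMField.complexConj L) (n + n) (hermD L e dV hdV dW hdW),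
      a ∈ Cinf ↔ S⁻¹ * (a : GL (Fin (n + n)) (mixedSpace L)) * S ∈
        arch (Fp L) L (IsCMField.complexConj L) (n + n) (1 : Matrix (Fin (n + n)) (Fin (n + n)) L))
    (hKC : ∀ k : HA L e dV hdV dW hdW, k ∈ 𝒦.K →
      archPart (Fp L) L (IsCMField.complexConj L) (n + n) (hermD L e dV hdV dW hdW) k ∈ Cinf)
    (h : HA L e dV hdV dW hdW) :
    HasDerivAt (fun t : ℝ => modDelta L e dV hdV dW hdW (𝒦.pPart
        (h * archExp (Fp L) L (IsCMField.complexConj L) (n + n) (hermD L e dV hdV dW hdW) hX t)))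
      (modDelta L e dV hdV dW hdW (𝒦.pPart h) * heightDeriv 𝒦 S X h) 0 := by
  have hfun : (fun t : ℝ => modDelta L e dV hdV dW hdW (𝒦.pPart
      (h * archExp (Fp L) L (IsCMField.complexConj L) (n + n) (hermD L e dV hdV dW hdW) hX t))) =
      fun t : ℝ => modDelta L e dV hdV dW hdW (𝒦.pPart h) *
        gramHeightFun L S (archPart (Fp L) L (IsCMField.complexConj L) (n + n) (hermD L e dV hdV dW hdW) (𝒦.kPart h) :
          GL (Fin (n + n)) (mixedSpace L)) (NormedSpace.exp (-(t • X))) := by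
    funext t
    rw [archExp_eq_archEmb, iwasawaHeight_mul_archEmb L e dV hdV hdV0 dW hdW hdW0 𝒦 h𝒦 h,
      iwasawaHeight_archEmb_expGL_eq L e dV hdV hdV0 dW hdW hdW0 𝒦 h𝒦 hC hKC _ ((archSkew _ _ _ _ _).smul_mem t hX)]
  rw [hfun, heightDeriv_def]
  exact (hasDerivAt_gramHeightFun_exp L S _ X).const_mul _

/-- **conjugating the orbit past `k ∈ H(𝔸)`**: `k · (E, 1) = (k_∞ E k_∞⁻¹, 1) · k` (`k = (k_∞,1)(1,k_f)` and the two embeddings commute).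
[cite: BorelJacquet1979, §4.1] [cite: Knapp2002, 0.§2] -/
theorem mul_archEmb_eq_archEmb_conj_mul (k : HA L e dV hdV dW hdW) (E : arch (Fp L) L (IsCMField.complexConj L) (n + n) (hermD L e dV hdV dW hdW)) :
    k * archEmb (Fp L) L (IsCMField.complexConj L) (n + n) (hermD L e dV hdV dW hdW) E =
      archEmb (Fp L) L (IsCMField.complexConj L) (n + n) (hermD L e dV hdV dW hdW)
          (archPart (Fp L) L (IsCMField.complexConj L) (n + n) (hermD L e dV hdV dW hdW) k * E *
            (archPart (Fp L) L (IsCMField.complexConj L) (n + n) (hermD L e dV hdV dW hdW) k)⁻¹) * k := by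
  set aE := archEmb (Fp L) L (IsCMField.complexConj L) (n + n) (hermD L e dV hdV dW hdW) with haE
  set fE := finEmb (Fp L) L (IsCMField.complexConj L) (n + n) (hermD L e dV hdV dW hdW) with hfE
  set a := archPart (Fp L) L (IsCMField.complexConj L) (n + n) (hermD L e dV hdV dW hdW) k with ha
  set b := finPart (Fp L) L (IsCMField.complexConj L) (n + n) (hermD L e dV hdV dW hdW) k with hb
  have hk : k = aE a * fE b := (archEmb_mul_finEmb (Fp L) L (IsCMField.complexConj L) (n + n) (hermD L e dV hdV dW hdW) k).symm
  calc k * aE E = aE a * fE b * aE E := by rw [hk]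
    _ = aE a * aE E * fE b := by rw [mul_assoc, ← archEmb_mul_finEmb_comm, ← mul_assoc]
    _ = aE (a * E * a⁻¹) * (aE a * fE b) := by
        rw [map_mul, map_mul, map_inv]
        group
    _ = aE (a * E * a⁻¹) * k := by rw [← hk]

include hdV0 hdW0 in
/-- **the derivative along the orbit through `h · k'`, `k' ∈ K`**, computed at the base point `h`: it is
`Φ_𝒦 h · (D gramHeightFun_{S,c_h})(1)(−k'_∞ X k'_∞⁻¹)` (`k' γ_X(t) = (Ad(k'_∞) exp tX, 1) k'`, right `K`-invariance, ★ B2 unitary invariance).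
[cite: KudlaRallis1994, §1] [cite: Knapp2002, 0.§2] -/
theorem hasDerivAt_iwasawaHeight_orbit_mul_K (h𝒦 : 𝒦.IsStd)
    (hC : ∀ a : arch (Fp L) L (IsCMField.complexConj L) (n + n) (hermD L e dV hdV dW hdW),
      a ∈ Cinf ↔ S⁻¹ * (a : GL (Fin (n + n)) (mixedSpace L)) * S ∈
        arch (Fp L) L (IsCMField.complexConj L) (n + n) (1 : Matrix (Fin (n + n)) (Fin (n + n)) L))
    (hKC : ∀ k : HA L e dV hdV dW hdW, k ∈ 𝒦.K →
      archPart (Fp L) L (IsCMField.complexConj L) (n + n) (hermD L e dV hdV dW hdW) k ∈ Cinf)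
    (h : HA L e dV hdV dW hdW) {k' : HA L e dV hdV dW hdW} (hk' : k' ∈ 𝒦.K) :
    HasDerivAt (fun t : ℝ => modDelta L e dV hdV dW hdW (𝒦.pPart
        (h * k' * archExp (Fp L) L (IsCMField.complexConj L) (n + n) (hermD L e dV hdV dW hdW) hX t)))
      (modDelta L e dV hdV dW hdW (𝒦.pPart h) *
        (fderiv ℝ (gramHeightFun L S (archPart (Fp L) L (IsCMField.complexConj L) (n + n) (hermD L e dV hdV dW hdW) (𝒦.kPart h) :
            GL (Fin (n + n)) (mixedSpace L))) 1)
          (-(((archPart (Fp L) L (IsCMField.complexConj L) (n + n) (hermD L e dV hdV dW hdW) k' :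
              arch (Fp L) L (IsCMField.complexConj L) (n + n) (hermD L e dV hdV dW hdW)) : GL (Fin (n + n)) (mixedSpace L)) * X *
            (((archPart (Fp L) L (IsCMField.complexConj L) (n + n) (hermD L e dV hdV dW hdW) k' :
              arch (Fp L) L (IsCMField.complexConj L) (n + n) (hermD L e dV hdV dW hdW))⁻¹ : GL (Fin (n + n)) (mixedSpace L)))))) 0 := by
  set a := archPart (Fp L) L (IsCMField.complexConj L) (n + n) (hermD L e dV hdV dW hdW) k' with ha
  set ch := archPart (Fp L) L (IsCMField.complexConj L) (n + n) (hermD L e dV hdV dW hdW) (𝒦.kPart h) with hch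
  have haU : S⁻¹ * (a : GL (Fin (n + n)) (mixedSpace L)) * S ∈
      arch (Fp L) L (IsCMField.complexConj L) (n + n) (1 : Matrix (Fin (n + n)) (Fin (n + n)) L) := (hC a).1 (hKC k' hk')
  have hainv : archEmb (Fp L) L (IsCMField.complexConj L) (n + n) (hermD L e dV hdV dW hdW) a⁻¹ ∈ 𝒦.K := by
    rw [map_inv]; exact 𝒦.K.inv_mem (archEmb_archPart_mem h𝒦 hk')
  have hfun : (fun t : ℝ => modDelta L e dV hdV dW hdW (𝒦.pPart
      (h * k' * archExp (Fp L) L (IsCMField.complexConj L) (n + n) (hermD L e dV hdV dW hdW) hX t))) =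
      fun t : ℝ => modDelta L e dV hdV dW hdW (𝒦.pPart h) *
        gramHeightFun L S (ch : GL (Fin (n + n)) (mixedSpace L))
          (NormedSpace.exp (-(t • (((a : GL (Fin (n + n)) (mixedSpace L)) : Matrix (Fin (n + n)) (Fin (n + n)) (mixedSpace L)) * X *
            ((a⁻¹ : GL (Fin (n + n)) (mixedSpace L)) : Matrix (Fin (n + n)) (Fin (n + n)) (mixedSpace L)))))) := by
    funext t
    rw [mul_assoc h k', archExp_eq_archEmb, mul_archEmb_eq_archEmb_conj_mul, ← mul_assoc,
      iwasawaHeight_mul_K L e dV hdV hdV0 dW hdW hdW0 𝒦 _ hk', iwasawaHeight_mul_archEmb L e dV hdV hdV0 dW hdW hdW0 𝒦 h𝒦 h, ← ha, ← hch,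
      show ch * (a * ⟨expGL (t • X), expGL_smul_mem_arch (hermD L e dV hdV dW hdW) hX t⟩ * a⁻¹) =
        ch * a * ⟨expGL (t • X), expGL_smul_mem_arch (hermD L e dV hdV dW hdW) hX t⟩ * a⁻¹ by group,
      iwasawaHeight_archEmb_mul_of_mem L e dV hdV hdV0 dW hdW hdW0 𝒦 hainv,
      iwasawaHeight_archEmb_expGL_eq L e dV hdV hdV0 dW hdW hdW0 𝒦 h𝒦 hC hKC (ch * a) ((archSkew _ _ _ _ _).smul_mem t hX),
      Subgroup.coe_mul, gramHeightFun_mul_right L S _ _ haU,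
      show ((a : GL (Fin (n + n)) (mixedSpace L)) : Matrix (Fin (n + n)) (Fin (n + n)) (mixedSpace L)) * NormedSpace.exp (-(t • X)) *
          ((((a : GL (Fin (n + n)) (mixedSpace L)))⁻¹ : GL (Fin (n + n)) (mixedSpace L)) : Matrix (Fin (n + n)) (Fin (n + n)) (mixedSpace L)) =
        NormedSpace.exp (-(t • (((a : GL (Fin (n + n)) (mixedSpace L)) : Matrix (Fin (n + n)) (Fin (n + n)) (mixedSpace L)) * X *
          ((a⁻¹ : GL (Fin (n + n)) (mixedSpace L)) : Matrix (Fin (n + n)) (Fin (n + n)) (mixedSpace L))))) by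
        rw [← NormedSpace.exp_units_conj, Matrix.mul_neg, Matrix.neg_mul, Matrix.mul_smul, Matrix.smul_mul]]
  rw [hfun]
  exact (hasDerivAt_gramHeightFun_exp L S _ _).const_mul _

include hX hdV0 hdW0 in
/-- **right `K`-translates of the log-derivative**: `H_X(h k') = (D gramHeightFun_{S,c_h})(1)(−k'_∞ X k'_∞⁻¹)` for `k' ∈ K`
(uniqueness of derivatives; `Φ_𝒦(h k') = Φ_𝒦 h > 0`). [cite: KudlaRallis1994, §1] [cite: Knapp2002, 0.§2] -/
theorem heightDeriv_mul_K (h𝒦 : 𝒦.IsStd)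
    (hC : ∀ a : arch (Fp L) L (IsCMField.complexConj L) (n + n) (hermD L e dV hdV dW hdW),
      a ∈ Cinf ↔ S⁻¹ * (a : GL (Fin (n + n)) (mixedSpace L)) * S ∈
        arch (Fp L) L (IsCMField.complexConj L) (n + n) (1 : Matrix (Fin (n + n)) (Fin (n + n)) L))
    (hKC : ∀ k : HA L e dV hdV dW hdW, k ∈ 𝒦.K →
      archPart (Fp L) L (IsCMField.complexConj L) (n + n) (hermD L e dV hdV dW hdW) k ∈ Cinf)
    (h : HA L e dV hdV dW hdW) {k' : HA L e dV hdV dW hdW} (hk' : k' ∈ 𝒦.K) :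
    heightDeriv 𝒦 S X (h * k') =
      (fderiv ℝ (gramHeightFun L S (archPart (Fp L) L (IsCMField.complexConj L) (n + n) (hermD L e dV hdV dW hdW) (𝒦.kPart h) :
          GL (Fin (n + n)) (mixedSpace L))) 1)
        (-(((archPart (Fp L) L (IsCMField.complexConj L) (n + n) (hermD L e dV hdV dW hdW) k' :
            arch (Fp L) L (IsCMField.complexConj L) (n + n) (hermD L e dV hdV dW hdW)) : GL (Fin (n + n)) (mixedSpace L)) * X *
          (((archPart (Fp L) L (IsCMField.complexConj L) (n + n) (hermD L e dV hdV dW hdW) k' :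
            arch (Fp L) L (IsCMField.complexConj L) (n + n) (hermD L e dV hdV dW hdW))⁻¹ : GL (Fin (n + n)) (mixedSpace L))))) := by
  have h1 := hasDerivAt_iwasawaHeight_orbit L e dV hdV hdV0 dW hdW hdW0 𝒦 hX h𝒦 hC hKC (h * k')
  have h2 := hasDerivAt_iwasawaHeight_orbit_mul_K L e dV hdV hdV0 dW hdW hdW0 𝒦 hX h𝒦 hC hKC h hk'
  have h3 := h1.unique h2
  rw [iwasawaHeight_mul_K L e dV hdV hdV0 dW hdW hdW0 𝒦 h hk'] at h3
  exact mul_left_cancel₀ (modDelta_pos L e dV hdV dW hdW _).ne' h3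

include hX hdV0 hdW0 in
/-- **`hHK`: the log-derivative `H_X` is `K`-finite** — all its right `K`-translates lie in the complex span of the image of the finite-dimensional
real space `M_{2n}(L ⊗ ℝ)` under the linear map `Z ↦ (h ↦ (D gramHeightFun_{S,c_h})(1)(Z))`. [cite: HarrisKudlaSweet1996, (1.16)] [cite: KudlaRallis1994, §1] -/
theorem isKFinite_heightDeriv (h𝒦 : 𝒦.IsStd)
    (hC : ∀ a : arch (Fp L) L (IsCMField.complexConj L) (n + n) (hermD L e dV hdV dW hdW),
      a ∈ Cinf ↔ S⁻¹ * (a : GL (Fin (n + n)) (mixedSpace L)) * S ∈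
        arch (Fp L) L (IsCMField.complexConj L) (n + n) (1 : Matrix (Fin (n + n)) (Fin (n + n)) L))
    (hKC : ∀ k : HA L e dV hdV dW hdW, k ∈ 𝒦.K →
      archPart (Fp L) L (IsCMField.complexConj L) (n + n) (hermD L e dV hdV dW hdW) k ∈ Cinf) :
    Literature.NumberTheory.K2Lit.SiegelDoubled.IsKFinite 𝒦 (fun h => (heightDeriv 𝒦 S X h : ℂ)) := by
  -- the real-linear map `Z ↦ (h ↦ (D gramHeightFun_{c_h})(1)(Z))`
  let Λ : Matrix (Fin (n + n)) (Fin (n + n)) (mixedSpace L) →ₗ[ℝ] (HA L e dV hdV dW hdW → ℂ) :=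
    { toFun := fun Z h => ((fderiv ℝ (gramHeightFun L S (archPart (Fp L) L (IsCMField.complexConj L) (n + n) (hermD L e dV hdV dW hdW)
          (𝒦.kPart h) : GL (Fin (n + n)) (mixedSpace L))) 1) Z : ℂ)
      map_add' := fun Z Z' => funext fun h => by simp only [map_add, Complex.ofReal_add, Pi.add_apply]
      map_smul' := fun r Z => funext fun h => by
        simp only [map_smul, smul_eq_mul, Complex.ofReal_mul, Pi.smul_apply, RingHom.id_apply, Complex.real_smul] }
  -- a finite spanning family: the images of a real basis of the matrix space
  let b := Module.finBasis ℝ (Matrix (Fin (n + n)) (Fin (n + n)) (mixedSpace L))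
  let W : Submodule ℂ (HA L e dV hdV dW hdW → ℂ) := Submodule.span ℂ (Set.range fun i => Λ (b i))
  haveI hW : FiniteDimensional ℂ W := FiniteDimensional.span_of_finite ℂ (Set.finite_range _)
  have hΛ : ∀ Z, Λ Z ∈ W := by
    intro Z
    rw [← b.sum_repr Z, map_sum]
    refine Submodule.sum_mem _ fun i _ => ?_
    rw [map_smul]
    have hs : (b.repr Z i) • Λ (b i) = ((b.repr Z i : ℝ) : ℂ) • Λ (b i) := by
      funext h
      simp only [Pi.smul_apply, Complex.real_smul, smul_eq_mul]
    rw [hs]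
    exact W.smul_mem _ (Submodule.subset_span ⟨i, rfl⟩)
  -- every right `K`-translate of `H_X` is such an image
  unfold Literature.NumberTheory.K2Lit.SiegelDoubled.IsKFinite
  refine Submodule.finiteDimensional_of_le (S₂ := W) (Submodule.span_le.2 ?_)
  rintro _ ⟨k', rfl⟩
  have hfun : (fun h : HA L e dV hdV dW hdW => (heightDeriv 𝒦 S X (h * (k' : HA L e dV hdV dW hdW)) : ℂ)) =
      Λ (-(((archPart (Fp L) L (IsCMField.complexConj L) (n + n) (hermD L e dV hdV dW hdW) (k' : HA L e dV hdV dW hdW) :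
            arch (Fp L) L (IsCMField.complexConj L) (n + n) (hermD L e dV hdV dW hdW)) : GL (Fin (n + n)) (mixedSpace L)) * X *
          (((archPart (Fp L) L (IsCMField.complexConj L) (n + n) (hermD L e dV hdV dW hdW) (k' : HA L e dV hdV dW hdW) :
            arch (Fp L) L (IsCMField.complexConj L) (n + n) (hermD L e dV hdV dW hdW))⁻¹ : GL (Fin (n + n)) (mixedSpace L))))) := by
    funext h
    rw [heightDeriv_mul_K L e dV hdV hdV0 dW hdW hdW0 𝒦 hX h𝒦 hC hKC h k'.2]
    rfl
  change (fun h : HA L e dV hdV dW hdW => (heightDeriv 𝒦 S X (h * (k' : HA L e dV hdV dW hdW)) : ℂ)) ∈ (W : Set (HA L e dV hdV dW hdW → ℂ))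
  rw [hfun]
  exact hΛ _

include hdV0 hdW0 in
/-- **«(D-ht)» PAID: the log-derivative of the Iwasawa height along `h · γ_X(t)` exists and is `K`-finite** for every STANDARD Iwasawa datum and
every `X ∈ 𝔥_∞` — the by-value inputs `hH`, `hHK` of ★ `K2LiuFlatSectionLieDerivative.hasDerivAt_stdExtension_orbit` ∕
`isStandardSectionFamily_heightDeriv_mul`. [cite: KudlaRallis1994, §1] [cite: Tan1999, §1 p. 166] [cite: HarrisKudlaSweet1996, (1.16)–(1.17)] -/
theorem exists_heightDeriv_of_isStd (h𝒦 : 𝒦.IsStd) :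
    ∃ H : HA L e dV hdV dW hdW → ℝ,
      (∀ h : HA L e dV hdV dW hdW,
        HasDerivAt (fun t : ℝ => modDelta L e dV hdV dW hdW (𝒦.pPart
            (h * archExp (Fp L) L (IsCMField.complexConj L) (n + n) (hermD L e dV hdV dW hdW) hX t)))
          (modDelta L e dV hdV dW hdW (𝒦.pPart h) * H h) 0) ∧
      Literature.NumberTheory.K2Lit.SiegelDoubled.IsKFinite 𝒦 (fun h => (H h : ℂ)) := by
  obtain ⟨Cinf, S, -, hC, -, hKC⟩ := h𝒦.exists_arch
  exact ⟨heightDeriv 𝒦 S X, hasDerivAt_iwasawaHeight_orbit L e dV hdV hdV0 dW hdW hdW0 𝒦 hX h𝒦 hC hKC,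
    isKFinite_heightDeriv L e dV hdV hdV0 dW hdW hdW0 𝒦 hX h𝒦 hC hKC⟩

end Orbit

end Summit.HodgeConjecture.HodgeConjecture.Cruxes.HLiu418.K2LiuIwasawaHeightLieDerivative
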